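import Summits.BirchSwinnertonDyer.BirchSwinnertonDyer.Theorems.ThetaPartnerAtTwoSignedKatoUpToAtTwoFlatKernelPlus
import Summits.BirchSwinnertonDyer.BirchSwinnertonDyer.Theorems.ThetaPartnerAtTwoSignedTransportAtTwoResidualUpper
import Summits.BirchSwinnertonDyer.BirchSwinnertonDyer.Theorems.ThetaPartnerAtTwoSignedControlAtTwoPlusLocalInjOfHonda
import Summits.BirchSwinnertonDyer.BirchSwinnertonDyer.Theorems.ByReductionTypeAtTwoSupersingularTowerTorsionTwo
import Literature.NumberTheory.EllipticCurves.Sprung2012.SharpFlatSelmer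
import HarnessLib

/-!
# Route `ThetaPartnerAtTwo` (TP2), crux K3 `SignedKatoDivisibilityUpToAtTwo` (item stmt-BirchSwinnertonDyer-20308),
# line `colemanrat` v3 — file 17: **KOBAYASHI's `Sel⁺(E/K_∞)` (Def. 1.1, the object of K3) lies inside SPRUNG's `Sel♭(E/K_∞)`
# (Def. 7.11, the object of the `bsd-2adic` cell's ♭ road) at `a_p = 0`**, for any Honda system of `a_p = 0` shape —
# hence `X♭ ↠ X⁺`: Kato's divisibility for `X♭` at `2` implies it for `X⁺` (K3) on the theta habitat

HONEST FRAMING (cell `bsd-wall`, width seat `bsd-wall-tp2-p2x-w2` g2): THEOREMS ONLY — no definition, no named fact, no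
instance, no `sorry`; the Honda clauses and the local generator lift are DISPLAYED HYPOTHESES (at `p = 2` on the theta habitat
they are the body of K4's stub `stub_plusHondaSystemTwo`); nothing about any curve is asserted beyond them; closes no item;
BSD is NOT proved by any of this.

## Why this file

File 16 (`…FlatKernelPlus`) identified, at `a_p = 0`, Sprung's ♭ Coleman kernel `Ker Col♭ ⊆ Hom(E(K_∞·K_v), ℤ_p)` with the
annihilator of Kobayashi's plus groups `E⁺(K_n·K_v)`. Sprung's ♭ LOCAL CONDITION (Def. 7.9) is the set of Kummer classes
`x ⊗ p^{−k}` (`x ∈ E(K_∞·K_v)`) with `p^k ∣ z(x)` for all `z ∈ Ker Col♭` (`Sprung2012.sharpFlatLocalKummerOverOfEmb`), Kobayashi's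
plus condition is the set of Kummer classes of `⨆_n E⁺(K_n·K_v)` (`Kobayashi2003.localKummerOverOfEmb`). Since `Ker Col♭` kills
`⨆_n E⁺_n` (file 16 (B)), the plus condition IMPLIES the ♭ condition (§1), and globally **`Sel⁺(E/K_∞) ≤ Sel♭(E/K_∞)`** (§2;
the signed Kummer description of `Sel⁺_∞` over `K_∞` is the tree's `conjH1_mem_localKummerOverOfEmb_iSup_of_mem_signedSelmerInfty`).
Dually `X♭ ↠ X⁺`, so `char_Λ X⁺ ∣ char_Λ X♭`: a ♭-Kato divisibility `char X♭ ∣ 2^m·L♭` at `2` (the currency of crux 19097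
`SupersingularRankZeroAtTwo`, cell `bsd-2adic`) would give K3's `char X⁺ ∣ 2^m ϖ L♭` — ONE `p = 2` statement serves both routes.
The reverse inclusion `Sel♭ ≤ Sel⁺` (exact annihilator) is not done here.

## What is proved

* §1 (any `K`, `p`, `κ`, `E`, `ι`, `W`, any `H ≤ Γ_K`; Honda clauses (L) (TR) (GEN) (GEN₀) of `a_p = 0` shape, (NT), (IDX), local
  lift `g`): `apply_eq_zero_of_mem_colemanKer_flat_of_mem_iSup_plus` (`Ker Col♭` kills `⨆_n E⁺_n`),
  **`localKummerOverOfEmb_iSup_plus_le_sharpFlatLocalKummer`** (Kobayashi's plus Kummer condition ≤ Sprung's ♭ condition).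
* §2 (`K` a number field): **`signedSelmerInfty_le_sharpFlatSelmerInfty_flat`**: `Sel⁺(E/K_∞) ≤ Sel♭(E/K_∞)` at the place `v ∋ p`
  with the chosen embedding (`K` with ONE place above `p`, as for `ℚ`: the ♭ group is typed at one place); `…_two`: `K = ℚ`,
  `p = 2`, `W` globally minimal with `GoodSS W 2`, `κ` cyclotomic — (NT) and (IDX) discharged (`SSFlatEC.eq_zero_of_mem_localTowerPointsOfEmb_of_two_nsmul`,
  `SignedEC.index_subgroupOf_localLayerSubgroupOfEmb_succ_eq`), leaving exactly HONDA⁺@2's clauses and the lift `g`.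

References: [Kobayashi2003] S. Kobayashi, Invent. Math. 152 (2003), Def. 1.1, Thm. 8.18–Prop. 8.23; [Sprung2012] F. Sprung,
J. Number Theory 132 (2012), Def. 7.9, Def. 7.11, Thm. 7.14, Open Problem 7.22; [GreenbergLNM1716] §2 (Kummer conditions).
-/

set_option autoImplicit false
-- the Theorems namespace of this sub repeats the summit name by design (D-0017 nested layout)
set_option linter.dupNamespace false

noncomputable section

open scoped Classical NumberField

universe u

namespace Summit.BirchSwinnertonDyer.BirchSwinnertonDyer.Theorems

namespace SignedKatoOffTwo.FlatKernel

open NumberField IsDedekindDomain WeierstrassCurve Literature.NumberTheory.EllipticCurves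
  Literature.NumberTheory.GaloisRepresentations Literature.NumberTheory.EllipticCurves.ZpExtension
  Literature.NumberTheory.EllipticCurves.Kobayashi2003 Literature.NumberTheory.EllipticCurves.Sprung2017
  Literature.NumberTheory.EllipticCurves.Sprung2012 Literature.NumberTheory.EllipticCurves.Rank1Residual

/-! ## §1 The plus Kummer condition implies the ♭ condition (local, any base) -/

section Local

variable {K : Type u} [Field K] {p : ℕ} [hp : Fact p.Prime] (κ : ZpExtension K p)
variable {E : Type u} [Field E] [Algebra K E] (ι : AlgebraicClosure K →ₐ[K] AlgebraicClosure E)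
variable (W : WeierstrassCurve K)

/-- `⨆_n E⁺(K_n·K_v) ≤ E(K_∞·K_v)` (each plus group lies in its layer, each layer in the tower). [cite: Kobayashi2003, Def. 1.1] -/
theorem iSup_plus_le_localTowerPointsOfEmb :
    (⨆ n : ℕ, signedLocalPointsOfEmb κ ι W 1 n) ≤ localTowerPointsOfEmb κ ι W :=
  iSup_le fun n => (signedLocalPointsOfEmb_le κ ι W 1 n).trans (localLayerPointsOfEmb_le_localTowerPointsOfEmb κ ι W n)

/-- **`Ker Col♭` kills `⨆_n E⁺(K_n·K_v)`** (file 16 (B) on each plus group, extended to the `⨆` by additivity), under the Honda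
clauses of `a_p = 0` shape, (NT), (IDX) and a local generator lift `g`. [cite: Kobayashi2003, Thm. 8.18–Prop. 8.23]
[cite: Sprung2012, Def. 7.9 (p. 1503)] -/
theorem apply_eq_zero_of_mem_colemanKer_flat_of_mem_iSup_plus {g : Field.absoluteGaloisGroup E}
    (hg : κ.IsTopGenerator (resGalOfEmb ι g))
    (hnt : ∀ P ∈ localTowerPointsOfEmb κ ι W, p • P = 0 → P = 0)
    (hidx : ∀ m : ℕ, ((localLayerSubgroupOfEmb κ ι (m + 1)).subgroupOf (localLayerSubgroupOfEmb κ ι m)).index = p)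
    {d : ℕ → localPoints W E} (hd : ∀ m, d m ∈ localLayerPointsOfEmb κ ι W m)
    (htr : ∀ m, localTraceOfEmb κ ι W (m + 1) (m + 2) (d (m + 2)) = -d m)
    (hgen : ∀ m : ℕ, 1 ≤ m → ∀ P ∈ localLayerPointsOfEmb κ ι W m,
      ∃ B ∈ AddSubgroup.closure (Set.range fun σ : Field.absoluteGaloisGroup E ↦ σ • d m),
        ∃ P' ∈ localLayerPointsOfEmb κ ι W (m - 1), ∃ R ∈ localLayerPointsOfEmb κ ι W m, P = B + P' + p • R)
    (hgen0 : ∀ P ∈ localLayerPointsOfEmb κ ι W 0, ∃ a : ℤ, ∃ R ∈ localLayerPointsOfEmb κ ι W 0, P = a • d 0 + p • R)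
    {z : localTowerPointsOfEmb κ ι W →+ ℤ_[p]} (hz : z ∈ colemanKer κ ι W 0 g d .flat)
    {x : localPoints W E} (hx : x ∈ ⨆ n : ℕ, signedLocalPointsOfEmb κ ι W 1 n) :
    z ⟨x, iSup_plus_le_localTowerPointsOfEmb κ ι W hx⟩ = 0 := by
  refine AddSubgroup.iSup_induction' (fun n : ℕ => signedLocalPointsOfEmb κ ι W 1 n)
    (C := fun y hy => z ⟨y, iSup_plus_le_localTowerPointsOfEmb κ ι W hy⟩ = 0) ?_ ?_ ?_ hx
  · intro n y hy
    exact apply_eq_zero_of_mem_colemanKer_flat_of_mem_plus κ ι W hg hnt hidx hd htr hgen hgen0 hz n _ hy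
  · exact (congrArg z (Subtype.ext rfl)).trans (map_zero z)
  · intro a b ha hb hza hzb
    have hab : (⟨a + b, iSup_plus_le_localTowerPointsOfEmb κ ι W (add_mem ha hb)⟩ : localTowerPointsOfEmb κ ι W) =
        ⟨a, iSup_plus_le_localTowerPointsOfEmb κ ι W ha⟩ + ⟨b, iSup_plus_le_localTowerPointsOfEmb κ ι W hb⟩ :=
      Subtype.ext rfl
    rw [hab, map_add, hza, hzb, add_zero]

/-- **Kobayashi's plus Kummer condition ≤ Sprung's ♭ Kummer condition, at `a_p = 0`** (any `H ≤ Γ_K`, e.g. `H = Gal(K̄/K_∞)`):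
a class whose restriction at `ι` is the Kummer cocycle of `Q` with `p^k Q ∈ ⨆_n E⁺(K_n·K_v)` satisfies Sprung's condition
«`p^k Q ∈ E(K_∞·K_v)` and `p^k ∣ z(p^k Q)` for all `z ∈ Ker Col♭`» — indeed `z(p^k Q) = 0`. [cite: Sprung2012, Def. 7.9 and Def. 7.11 (p. 1503)]
[cite: Kobayashi2003, Def. 1.1 and Thm. 8.18–Prop. 8.23] -/
theorem localKummerOverOfEmb_iSup_plus_le_sharpFlatLocalKummer (H : Subgroup (Field.absoluteGaloisGroup K))
    {g : Field.absoluteGaloisGroup E} (hg : κ.IsTopGenerator (resGalOfEmb ι g))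
    (hnt : ∀ P ∈ localTowerPointsOfEmb κ ι W, p • P = 0 → P = 0)
    (hidx : ∀ m : ℕ, ((localLayerSubgroupOfEmb κ ι (m + 1)).subgroupOf (localLayerSubgroupOfEmb κ ι m)).index = p)
    {d : ℕ → localPoints W E} (hd : ∀ m, d m ∈ localLayerPointsOfEmb κ ι W m)
    (htr : ∀ m, localTraceOfEmb κ ι W (m + 1) (m + 2) (d (m + 2)) = -d m)
    (hgen : ∀ m : ℕ, 1 ≤ m → ∀ P ∈ localLayerPointsOfEmb κ ι W m,
      ∃ B ∈ AddSubgroup.closure (Set.range fun σ : Field.absoluteGaloisGroup E ↦ σ • d m),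
        ∃ P' ∈ localLayerPointsOfEmb κ ι W (m - 1), ∃ R ∈ localLayerPointsOfEmb κ ι W m, P = B + P' + p • R)
    (hgen0 : ∀ P ∈ localLayerPointsOfEmb κ ι W 0, ∃ a : ℤ, ∃ R ∈ localLayerPointsOfEmb κ ι W 0, P = a • d 0 + p • R) :
    localKummerOverOfEmb W p H ι (⨆ n : ℕ, signedLocalPointsOfEmb κ ι W 1 n) ≤
      sharpFlatLocalKummerOverOfEmb W p H ι (localTowerPointsOfEmb κ ι W) (colemanKer κ ι W 0 g d .flat) := by
  rintro c ⟨φ, Q, k, hc, hA, hτ⟩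
  refine ⟨φ, Q, k, iSup_plus_le_localTowerPointsOfEmb κ ι W hA, hc, fun z hz => ?_, hτ⟩
  rw [apply_eq_zero_of_mem_colemanKer_flat_of_mem_iSup_plus κ ι W hg hnt hidx hd htr hgen hgen0 hz hA]
  exact dvd_zero _

end Local

/-! ## §2 `Sel⁺(E/K_∞) ≤ Sel♭(E/K_∞)` -/

section Global

variable {K : Type u} [Field K] [NumberField K] (W : WeierstrassCurve K) {p : ℕ} [hp : Fact p.Prime]
  (κ : ZpExtension K p)

/-- **`Sel⁺(E/K_∞) ≤ Sel♭(E/K_∞)` at `a_p = 0`.** For a number field `K`, a `ℤ_p`-extension `κ`, a place `v ∋ p` of `K` with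
completion `K_v`, a local lift `g ∈ Γ_{K_v}` of the topological generator, and a Honda system `d` of `a_p = 0` shape on the
`ℤ_p`-tower at (`K_v`, `closureEmb`) with (NT), (IDX): Kobayashi's `signedSelmerInfty W κ 1` is contained in Sprung's
`sharpFlatSelmerInfty W κ (closureEmb K_v) 0 g d .flat` — the classical parts agree and, at every conjugate `conj_σ`, the plus Kummer
condition over `K_∞` (`conjH1_mem_localKummerOverOfEmb_iSup_of_mem_signedSelmerInfty`) implies the ♭ condition (§1). (Sprung's
group is typed at ONE place above `p`, as for `K = ℚ`.) [cite: Kobayashi2003, Def. 1.1] [cite: Sprung2012, Def. 7.11 (p. 1503)] -/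
theorem signedSelmerInfty_le_sharpFlatSelmerInfty_flat (v : HeightOneSpectrum (𝓞 K)) (hv : (p : 𝓞 K) ∈ v.asIdeal)
    {g : Field.absoluteGaloisGroup (v.adicCompletion K)}
    (hg : κ.IsTopGenerator (resGalOfEmb (closureEmb (K := K) (v.adicCompletion K)) g))
    (hnt : ∀ P ∈ localTowerPointsOfEmb κ (closureEmb (K := K) (v.adicCompletion K)) W, p • P = 0 → P = 0)
    (hidx : ∀ m : ℕ, ((localLayerSubgroupOfEmb κ (closureEmb (K := K) (v.adicCompletion K)) (m + 1)).subgroupOf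
      (localLayerSubgroupOfEmb κ (closureEmb (K := K) (v.adicCompletion K)) m)).index = p)
    {d : ℕ → localPoints W (v.adicCompletion K)}
    (hd : ∀ m, d m ∈ localLayerPoints κ (v.adicCompletion K) W m)
    (htr : ∀ m, localTrace κ (v.adicCompletion K) W (m + 1) (m + 2) (d (m + 2)) = -d m)
    (hgen : ∀ m : ℕ, 1 ≤ m → ∀ P ∈ localLayerPoints κ (v.adicCompletion K) W m,
      ∃ B ∈ AddSubgroup.closure (Set.range fun σ : Field.absoluteGaloisGroup (v.adicCompletion K) ↦ σ • d m),
        ∃ P' ∈ localLayerPoints κ (v.adicCompletion K) W (m - 1),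
          ∃ R ∈ localLayerPoints κ (v.adicCompletion K) W m, P = B + P' + p • R)
    (hgen0 : ∀ P ∈ localLayerPoints κ (v.adicCompletion K) W 0,
      ∃ a : ℤ, ∃ R ∈ localLayerPoints κ (v.adicCompletion K) W 0, P = a • d 0 + p • R) :
    signedSelmerInfty W κ 1 ≤
      sharpFlatSelmerInfty W κ (closureEmb (K := K) (v.adicCompletion K)) 0 g d .flat := by
  intro s hs
  rw [mem_sharpFlatSelmerInfty_iff]
  refine ⟨signedSelmerInfty_le_selmerInfty W κ 1 hs, fun σ => ?_⟩
  exact localKummerOverOfEmb_iSup_plus_le_sharpFlatLocalKummer κ (closureEmb (K := K) (v.adicCompletion K)) W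
    κ.kerSubgroup hg hnt hidx hd htr hgen hgen0
    (SignedTransportAtTwo.conjH1_mem_localKummerOverOfEmb_iSup_of_mem_signedSelmerInfty W κ 1 hs v hv σ)

/-- **`Sel⁺(E/ℚ_∞) ≤ Sel♭(E/ℚ_∞)` AT `p = 2` on the theta habitat, modulo HONDA⁺@2.** For `W/ℚ` globally minimal with `GoodSS W 2`,
the CYCLOTOMIC `κ`, the place `v ∋ 2`, a local lift `g` of the topological generator and a plus Honda system `d` at `2` (the four
clauses (L) (TR) (GEN) (GEN₀) of K4's `stub_plusHondaSystemTwo` at (`W`, `κ`, `v`)): `signedSelmerInfty W κ 1 ≤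
sharpFlatSelmerInfty W κ (closureEmb ℚ_v) 0 g d .flat` — (NT) by the `bsd-2adic` cell's tower torsion at `2`, (IDX) by the K4 seats'
layer degrees. Dually `X♭ ↠ X⁺ = D.X` for every `D : SignedSelmerDualData W κ γ 1`: the ♭-Kato divisibility at `2` implies K3's.
[cite: Kobayashi2003, Def. 1.1] [cite: Sprung2012, Def. 7.11, Thm. 7.14] [cite: KuriharaOtsuki2006, p. 557] -/
theorem signedSelmerInfty_le_sharpFlatSelmerInfty_flat_two (W : WeierstrassCurve ℚ) [W.IsElliptic] [W.IsGloballyMinimal]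
    (hss : GoodSS W 2) {κ : ZpExtension ℚ 2} (hκ : κ.IsCyclotomic) (v : HeightOneSpectrum (𝓞 ℚ)) (hv : (2 : 𝓞 ℚ) ∈ v.asIdeal)
    {g : Field.absoluteGaloisGroup (v.adicCompletion ℚ)}
    (hg : κ.IsTopGenerator (resGalOfEmb (closureEmb (K := ℚ) (v.adicCompletion ℚ)) g))
    {d : ℕ → localPoints W (v.adicCompletion ℚ)}
    (hd : ∀ m, d m ∈ localLayerPoints κ (v.adicCompletion ℚ) W m)
    (htr : ∀ m, localTrace κ (v.adicCompletion ℚ) W (m + 1) (m + 2) (d (m + 2)) = -d m)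
    (hgen : ∀ m : ℕ, 1 ≤ m → ∀ P ∈ localLayerPoints κ (v.adicCompletion ℚ) W m,
      ∃ B ∈ AddSubgroup.closure (Set.range fun σ : Field.absoluteGaloisGroup (v.adicCompletion ℚ) ↦ σ • d m),
        ∃ P' ∈ localLayerPoints κ (v.adicCompletion ℚ) W (m - 1),
          ∃ R ∈ localLayerPoints κ (v.adicCompletion ℚ) W m, P = B + P' + 2 • R)
    (hgen0 : ∀ P ∈ localLayerPoints κ (v.adicCompletion ℚ) W 0,
      ∃ a : ℤ, ∃ R ∈ localLayerPoints κ (v.adicCompletion ℚ) W 0, P = a • d 0 + 2 • R) :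
    signedSelmerInfty W κ 1 ≤
      sharpFlatSelmerInfty W κ (closureEmb (K := ℚ) (v.adicCompletion ℚ)) 0 g d .flat :=
  signedSelmerInfty_le_sharpFlatSelmerInfty_flat W κ v (by exact_mod_cast hv) hg
    (fun _ hP h2 => SSFlatEC.eq_zero_of_mem_localTowerPointsOfEmb_of_two_nsmul W hss κ hv _ hP h2)
    (SignedEC.index_subgroupOf_localLayerSubgroupOfEmb_succ_eq hκ v (by exact_mod_cast hv)) hd htr hgen hgen0

end Global

end SignedKatoOffTwo.FlatKernel

end Summit.BirchSwinnertonDyer.BirchSwinnertonDyer.Theorems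

end
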